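import Summits.QuantumFields.YangMills.Theorems.AllWindowsColdBoxBulkMidLocalToGlobalSandwichPrelims
import Summits.QuantumFields.YangMills.Theorems.SandwichVariancePinchingCeilingBL

/-!
# SUB-GAUSSIAN EXPONENTIAL MOMENTS of linear statistics under the second-difference sandwich
# (crux idea `logconcave-core-extension` on ⟨stmt-QuantumFields-24006⟩, piece P3(b): concentration of the
# log-concave surrogate on the core — the "Herbst/Brascamp–Lieb tail" input, smooth whitened case)

THEOREM (`expMoment_le_of_sandwich`, whitened frame, `A ∈ C²`).  Under the Euclidean sandwich
`(1−δ)|h|² ≤ A(x+h)+A(x−h)−2A(x) ≤ (1+δ)|h|²` (`0 ≤ δ < 1`), for every `b ∈ ℝⁿ` and `t ∈ ℝ`,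
`∫ e^{t·x·b − A(x)} dx ≤ exp(t·m + t²·|b|²/(2(1−δ))) · ∫ e^{−A}`,  `m = ∫(x·b)e^{−A}/∫e^{−A}`,
i.e. the centred linear statistic `x·b − m` is sub-Gaussian with variance proxy `|b|²/(1−δ)` — dimension-free.

PROOF (exponential tilting + Brascamp–Lieb).  The tilted potentials `A_s = A − s·(x·b)` are `C²` with the SAME
sandwich; `Z(s) = ∫e^{−A_s}` is twice differentiable in `s` (dominated differentiation under the integral,
Gaussian domination of the tilted weights), `Z' = ∫(x·b)e^{−A_s}`, `Z'' = ∫(x·b)²e^{−A_s}`; the tree's PROVED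
first-order Brascamp–Lieb inequality (`bl_raw_of_sandwich`, Brascamp–Lieb 1976 Thm 4.1) for `A_s` and the
linear observable `x·b` reads `Z''Z − Z'² ≤ |b|²Z²/(1−δ)`, i.e. `(log Z)'' ≤ |b|²/(1−δ)`; the one-dimensional
descent lemma (`LocalToGlobalSandwich.oneD_descent`) integrates it.

HONEST SCOPE.  Free-hands work of the LEAD seat of ⟨stmt-QuantumFields-24006⟩ (FCL lineage) on an ingredient of
an UN-TRIAGED crux idea card; classical log-concave probability over the tree's Brascamp–Lieb file.  No stub of
LINE-18, no crux, rung or summit is proved; the Yang–Mills mass gap is NOT proved by any of this.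
-/

noncomputable section

namespace Summit.QuantumFields.YangMills.Theorems.SandwichVariancePinching

open MeasureTheory Real Filter Topology Set
open Literature.Probability.Distributions (coordGradient)
open Summit.QuantumFields.YangMills.Theorems.LocalToGlobalSandwich (oneD_descent)

variable {n : ℕ}

/-! ## §1 Linear tilts preserve the sandwich -/

/-- Second differences of a linear functional vanish, so `A − s·(x·b)` has the same sandwich as `A`. [folklore] -/
theorem sandwich_tilt {A : (Fin n → ℝ) → ℝ} {δ : ℝ}
    (hsw : ∀ x h : Fin n → ℝ, (1 - δ) * (h ⬝ᵥ h) ≤ A (x + h) + A (x - h) - 2 * A x ∧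
      A (x + h) + A (x - h) - 2 * A x ≤ (1 + δ) * (h ⬝ᵥ h)) (b : Fin n → ℝ) (s : ℝ) (x h : Fin n → ℝ) :
    (1 - δ) * (h ⬝ᵥ h) ≤ (A (x + h) - s * ((x + h) ⬝ᵥ b)) + (A (x - h) - s * ((x - h) ⬝ᵥ b))
        - 2 * (A x - s * (x ⬝ᵥ b)) ∧
      (A (x + h) - s * ((x + h) ⬝ᵥ b)) + (A (x - h) - s * ((x - h) ⬝ᵥ b)) - 2 * (A x - s * (x ⬝ᵥ b))
        ≤ (1 + δ) * (h ⬝ᵥ h) := by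
  have h1 := hsw x h
  have e : (A (x + h) - s * ((x + h) ⬝ᵥ b)) + (A (x - h) - s * ((x - h) ⬝ᵥ b)) - 2 * (A x - s * (x ⬝ᵥ b))
      = A (x + h) + A (x - h) - 2 * A x := by
    simp only [add_dotProduct, sub_dotProduct]; ring
  rw [e]; exact h1

/-- The tilted potential `x ↦ A x − s·(x·b)` is `C²`. [folklore] -/
theorem contDiff_tilt {A : (Fin n → ℝ) → ℝ} (hA : ContDiff ℝ 2 A) (b : Fin n → ℝ) (s : ℝ) :
    ContDiff ℝ 2 (fun x => A x - s * (x ⬝ᵥ b)) := by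
  have h : ContDiff ℝ 2 (fun x : Fin n → ℝ => x ⬝ᵥ b) := by
    have e : (fun x : Fin n → ℝ => x ⬝ᵥ b) = fun x => ∑ i, x i * b i := by funext x; rfl
    rw [e]
    exact ContDiff.sum fun i _ => (contDiff_apply ℝ ℝ i).mul contDiff_const
  exact hA.sub (contDiff_const.mul h)

/-- `e^{−(A x − s·(x·b))} = e^{s·(x·b) − A x}`. [folklore] -/
theorem exp_neg_tilt (A : (Fin n → ℝ) → ℝ) (b : Fin n → ℝ) (s : ℝ) (x : Fin n → ℝ) :
    exp (-(A x - s * (x ⬝ᵥ b))) = exp (s * (x ⬝ᵥ b) - A x) := by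
  congr 1; ring

/-- Sup-norm growth of `x ↦ x·b`. [folklore] -/
theorem abs_dotProduct_const_le (b x : Fin n → ℝ) : |x ⬝ᵥ b| ≤ (∑ i, |b i|) * (1 + ‖x‖) ^ 1 := by
  rw [pow_one]
  calc |x ⬝ᵥ b| = |∑ i, x i * b i| := rfl
    _ ≤ ∑ i, |x i * b i| := Finset.abs_sum_le_sum_abs _ _
    _ ≤ ∑ i, |b i| * (1 + ‖x‖) := Finset.sum_le_sum fun i _ => by
        rw [abs_mul, mul_comm]
        refine mul_le_mul_of_nonneg_left ?_ (abs_nonneg _)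
        have : |x i| ≤ ‖x‖ := by simpa [Real.norm_eq_abs] using norm_le_pi_norm x i
        linarith
    _ = (∑ i, |b i|) * (1 + ‖x‖) := by rw [Finset.sum_mul]

/-! ## §2 The tilted partition function and its first two derivatives -/

/-- INTEGRABILITY of `w · e^{s·(x·b) − A}` for continuous polynomially bounded `w` (degree `≤ 8`). [folklore] -/
theorem integrable_tilt {A : (Fin n → ℝ) → ℝ} (hA : Continuous A) {δ : ℝ} (hδ1 : δ < 1)
    (hsw : ∀ x h : Fin n → ℝ, (1 - δ) * (h ⬝ᵥ h) ≤ A (x + h) + A (x - h) - 2 * A x ∧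
      A (x + h) + A (x - h) - 2 * A x ≤ (1 + δ) * (h ⬝ᵥ h)) (b : Fin n → ℝ) (s : ℝ)
    {w : (Fin n → ℝ) → ℝ} (hw : Continuous w) {D : ℝ} {k : ℕ} (hk : k ≤ 8)
    (hwb : ∀ x, |w x| ≤ D * (1 + ‖x‖) ^ k) :
    Integrable fun x => w x * exp (s * (x ⬝ᵥ b) - A x) := by
  have hAs : Continuous fun x => A x - s * (x ⬝ᵥ b) :=
    hA.sub (continuous_const.mul (continuous_id.dotProduct continuous_const))
  obtain ⟨C, κ, _, hκ, hlb⟩ := exists_quadratic_lower_of_sandwich hAs hδ1 (sandwich_tilt hsw b s)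
  have h := integrable_mul_exp_neg_of_growth hAs hw hκ hk hlb hwb
  refine h.congr (ae_of_all _ fun x => ?_)
  simp only [exp_neg_tilt]

/-- Pointwise domination of the tilted weights on a unit window of tilts:
`e^{s y} ≤ e^{(s₀+1) y} + e^{(s₀−1) y}` for `|s − s₀| < 1`. [folklore] -/
theorem exp_mul_le_window {s s₀ : ℝ} (hs : s ∈ Ioo (s₀ - 1) (s₀ + 1)) (y : ℝ) :
    exp (s * y) ≤ exp ((s₀ + 1) * y) + exp ((s₀ - 1) * y) := by
  rcases le_or_gt 0 y with hy | hy
  · have h1 : exp (s * y) ≤ exp ((s₀ + 1) * y) := exp_le_exp.mpr (by nlinarith [hs.2])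
    linarith [exp_pos ((s₀ - 1) * y)]
  · have h1 : exp (s * y) ≤ exp ((s₀ - 1) * y) := exp_le_exp.mpr (by nlinarith [hs.1])
    linarith [exp_pos ((s₀ + 1) * y)]

/-- DERIVATIVE OF THE TILTED MOMENTS: for a continuous polynomially bounded `w` (degree `≤ 6`),
`s ↦ ∫ w e^{s·(x·b) − A}` has derivative `∫ w·(x·b) e^{s·(x·b) − A}`. [folklore] -/
theorem hasDerivAt_integral_tilt {A : (Fin n → ℝ) → ℝ} (hA : Continuous A) {δ : ℝ} (hδ1 : δ < 1)
    (hsw : ∀ x h : Fin n → ℝ, (1 - δ) * (h ⬝ᵥ h) ≤ A (x + h) + A (x - h) - 2 * A x ∧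
      A (x + h) + A (x - h) - 2 * A x ≤ (1 + δ) * (h ⬝ᵥ h)) (b : Fin n → ℝ)
    {w : (Fin n → ℝ) → ℝ} (hw : Continuous w) {D : ℝ} {k : ℕ} (hk : k ≤ 6)
    (hwb : ∀ x, |w x| ≤ D * (1 + ‖x‖) ^ k) (s₀ : ℝ) :
    HasDerivAt (fun s => ∫ x, w x * exp (s * (x ⬝ᵥ b) - A x))
      (∫ x, w x * (x ⬝ᵥ b) * exp (s₀ * (x ⬝ᵥ b) - A x)) s₀ := by
  have hwb' : ∀ x, |w x * (x ⬝ᵥ b)| ≤ D * (∑ i, |b i|) * (1 + ‖x‖) ^ (k + 1) := fun x =>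
    abs_mul_le_growth hwb (abs_dotProduct_const_le b) x
  have hwc' : Continuous fun x => w x * (x ⬝ᵥ b) := hw.mul (continuous_id.dotProduct continuous_const)
  -- the dominating function
  set bound : (Fin n → ℝ) → ℝ := fun x =>
    |w x * (x ⬝ᵥ b)| * exp ((s₀ + 1) * (x ⬝ᵥ b) - A x) + |w x * (x ⬝ᵥ b)| * exp ((s₀ - 1) * (x ⬝ᵥ b) - A x)
    with hbound
  have hbi : Integrable bound := by
    have habs : ∀ x, |(|w x * (x ⬝ᵥ b)|)| ≤ D * (∑ i, |b i|) * (1 + ‖x‖) ^ (k + 1) := fun x => by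
      rw [abs_abs]; exact hwb' x
    exact (integrable_tilt hA hδ1 hsw b (s₀ + 1) hwc'.abs (by omega) habs).add
      (integrable_tilt hA hδ1 hsw b (s₀ - 1) hwc'.abs (by omega) habs)
  have hF_meas : ∀ᶠ s in 𝓝 s₀, AEStronglyMeasurable (fun x => w x * exp (s * (x ⬝ᵥ b) - A x)) volume :=
    Filter.Eventually.of_forall fun s =>
      (hw.mul (continuous_exp.comp ((continuous_const.mul (continuous_id.dotProduct
        continuous_const)).sub hA))).aestronglyMeasurable
  have hF_int : Integrable fun x => w x * exp (s₀ * (x ⬝ᵥ b) - A x) :=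
    integrable_tilt hA hδ1 hsw b s₀ hw (by omega) hwb
  have hF'_meas : AEStronglyMeasurable (fun x => w x * (x ⬝ᵥ b) * exp (s₀ * (x ⬝ᵥ b) - A x)) volume :=
    (hwc'.mul (continuous_exp.comp ((continuous_const.mul (continuous_id.dotProduct
      continuous_const)).sub hA))).aestronglyMeasurable
  have h := hasDerivAt_integral_of_dominated_loc_of_deriv_le (μ := volume)
    (F := fun s x => w x * exp (s * (x ⬝ᵥ b) - A x))
    (F' := fun s x => w x * (x ⬝ᵥ b) * exp (s * (x ⬝ᵥ b) - A x))
    (x₀ := s₀) (s := Ioo (s₀ - 1) (s₀ + 1)) (bound := bound)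
    (Ioo_mem_nhds (by linarith) (by linarith)) hF_meas hF_int hF'_meas ?_ hbi ?_
  · exact h.2
  · refine ae_of_all _ fun x s hs => ?_
    rw [Real.norm_eq_abs, abs_mul, abs_of_pos (exp_pos _), hbound]
    have hsub : exp (s * (x ⬝ᵥ b) - A x) ≤ exp ((s₀ + 1) * (x ⬝ᵥ b) - A x) + exp ((s₀ - 1) * (x ⬝ᵥ b) - A x) := by
      rw [Real.exp_sub, Real.exp_sub, Real.exp_sub, ← add_div]
      exact div_le_div_of_nonneg_right (exp_mul_le_window hs _) (exp_pos _).le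
    have := mul_le_mul_of_nonneg_left hsub (abs_nonneg (w x * (x ⬝ᵥ b)))
    linarith [this]
  · refine ae_of_all _ fun x s _ => ?_
    have h1 : HasDerivAt (fun s : ℝ => s * (x ⬝ᵥ b) - A x) (x ⬝ᵥ b) s := by
      simpa using (hasDerivAt_mul_const (x ⬝ᵥ b) (x := s)).sub_const (A x)
    have h2 := (h1.exp).const_mul (w x)
    have e : w x * (exp (s * (x ⬝ᵥ b) - A x) * (x ⬝ᵥ b)) = w x * (x ⬝ᵥ b) * exp (s * (x ⬝ᵥ b) - A x) := by
      ring
    rw [e] at h2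
    exact h2

/-! ## §3 Brascamp–Lieb for the tilted partition function and the sub-Gaussian bound -/

/-- BRASCAMP–LIEB FOR THE LINEAR OBSERVABLE under a tilted sandwiched `C²` potential:
`Z''Z − Z'² ≤ |b|²Z²/(1−δ)` where `Z = ∫e^{s·(x·b)−A}`, `Z' = ∫(x·b)e^{…}`, `Z'' = ∫(x·b)²e^{…}`. [folklore] -/
theorem bl_linear_tilt {A : (Fin n → ℝ) → ℝ} (hA : ContDiff ℝ 2 A) {δ : ℝ} (hδ1 : δ < 1)
    (hsw : ∀ x h : Fin n → ℝ, (1 - δ) * (h ⬝ᵥ h) ≤ A (x + h) + A (x - h) - 2 * A x ∧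
      A (x + h) + A (x - h) - 2 * A x ≤ (1 + δ) * (h ⬝ᵥ h)) (b : Fin n → ℝ) (s : ℝ) :
    (∫ x, (x ⬝ᵥ b) ^ 2 * exp (s * (x ⬝ᵥ b) - A x)) * (∫ x, exp (s * (x ⬝ᵥ b) - A x)) -
        (∫ x, (x ⬝ᵥ b) * exp (s * (x ⬝ᵥ b) - A x)) ^ 2 ≤
      (1 - δ)⁻¹ * (b ⬝ᵥ b) * (∫ x, exp (s * (x ⬝ᵥ b) - A x)) ^ 2 := by
  have hAs := contDiff_tilt hA b s
  have hsws := sandwich_tilt hsw b s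
  -- the linear observable and its derivative data
  obtain ⟨L, hL, hLv⟩ :=
    Literature.MathematicalPhysics.QuantumFieldTheory.Balaban1983to89.B14.Eq328GaussianIBP.hasFDerivAt_dotProduct_const
      b (0 : Fin n → ℝ)
  have hh : ContDiff ℝ 1 (fun x : Fin n → ℝ => x ⬝ᵥ b) := by
    have e : (fun x : Fin n → ℝ => x ⬝ᵥ b) = fun x => ∑ i, x i * b i := by funext x; rfl
    rw [e]
    exact ContDiff.sum fun i _ => (contDiff_apply ℝ ℝ i).mul contDiff_const
  have hfd : ∀ x : Fin n → ℝ, ∀ v, fderiv ℝ (fun y : Fin n → ℝ => y ⬝ᵥ b) x v = v ⬝ᵥ b := by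
    intro x v
    obtain ⟨Lx, hLx, hLxv⟩ :=
      Literature.MathematicalPhysics.QuantumFieldTheory.Balaban1983to89.B14.Eq328GaussianIBP.hasFDerivAt_dotProduct_const
        b x
    rw [hLx.fderiv, hLxv]
  have hgrad : ∀ x, coordGradient (fun y : Fin n → ℝ => y ⬝ᵥ b) x = b := by
    intro x; funext i
    simp only [coordGradient, hfd]
    simp [dotProduct, Pi.single_apply]
  have key := bl_raw_of_sandwich hAs hδ1 hsws hh (Dh := ∑ i, |b i|) (Dh' := ∑ i, |b i|)
    (fun x => growth_mono (by norm_num : 1 ≤ 3) (abs_dotProduct_const_le b) x)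
    (fun x j => by
      rw [hfd]
      have h1 : |(Pi.single j (1:ℝ) : Fin n → ℝ) ⬝ᵥ b| = |b j| := by simp [dotProduct, Pi.single_apply]
      rw [h1]
      have h2 : |b j| ≤ ∑ i, |b i| := Finset.single_le_sum (fun i _ => abs_nonneg (b i)) (Finset.mem_univ j)
      have h3 : (1:ℝ) ≤ (1 + ‖x‖) ^ 2 := one_le_pow₀ (by linarith [norm_nonneg x])
      nlinarith [Finset.sum_nonneg (fun i (_ : i ∈ Finset.univ) => abs_nonneg (b i))])
  simp only [hgrad, exp_neg_tilt] at key
  rw [integral_const_mul] at key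
  have e : (fun x : Fin n → ℝ => (x ⬝ᵥ b) ^ 2 * exp (s * (x ⬝ᵥ b) - A x)) =
      fun x => (x ⬝ᵥ b) ^ 2 * exp (s * (x ⬝ᵥ b) - A x) := rfl
  calc (∫ x, (x ⬝ᵥ b) ^ 2 * exp (s * (x ⬝ᵥ b) - A x)) * (∫ x, exp (s * (x ⬝ᵥ b) - A x)) -
        (∫ x, (x ⬝ᵥ b) * exp (s * (x ⬝ᵥ b) - A x)) ^ 2
      ≤ (1 - δ)⁻¹ * ((b ⬝ᵥ b) * ∫ x, exp (s * (x ⬝ᵥ b) - A x)) * ∫ x, exp (s * (x ⬝ᵥ b) - A x) := key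
    _ = (1 - δ)⁻¹ * (b ⬝ᵥ b) * (∫ x, exp (s * (x ⬝ᵥ b) - A x)) ^ 2 := by ring

/-- **SUB-GAUSSIAN EXPONENTIAL MOMENTS OF LINEAR STATISTICS** (whitened frame, `A ∈ C²`, `δ < 1` — only the
LOWER half of the sandwich matters):
`∫ e^{t·(x·b) − A} ≤ exp(t·m + t²|b|²/(2(1−δ)))·∫e^{−A}` with `m = ∫(x·b)e^{−A}/∫e^{−A}`.
[folklore: exponential tilting + Brascamp–Lieb 1976 Thm 4.1] -/
theorem expMoment_le_of_sandwich {A : (Fin n → ℝ) → ℝ} (hA : ContDiff ℝ 2 A) {δ : ℝ}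
    (hδ1 : δ < 1)
    (hsw : ∀ x h : Fin n → ℝ, (1 - δ) * (h ⬝ᵥ h) ≤ A (x + h) + A (x - h) - 2 * A x ∧
      A (x + h) + A (x - h) - 2 * A x ≤ (1 + δ) * (h ⬝ᵥ h)) (b : Fin n → ℝ) (t : ℝ) :
    (∫ x, exp (t * (x ⬝ᵥ b) - A x)) ≤
      exp (t * ((∫ x, (x ⬝ᵥ b) * exp (-A x)) / ∫ x, exp (-A x)) + t ^ 2 / 2 * ((b ⬝ᵥ b) / (1 - δ)))
        * ∫ x, exp (-A x) := by
  have hAc : Continuous A := hA.continuous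
  -- the tilted partition function and its derivatives
  set Z : ℝ → ℝ := fun s => ∫ x, exp (s * (x ⬝ᵥ b) - A x) with hZ
  set Z' : ℝ → ℝ := fun s => ∫ x, (x ⬝ᵥ b) * exp (s * (x ⬝ᵥ b) - A x) with hZ'
  set Z'' : ℝ → ℝ := fun s => ∫ x, (x ⬝ᵥ b) ^ 2 * exp (s * (x ⬝ᵥ b) - A x) with hZ''
  have hZd : ∀ s, HasDerivAt Z (Z' s) s := by
    intro s
    have h := hasDerivAt_integral_tilt hAc hδ1 hsw b continuous_const (w := fun _ => (1:ℝ)) (D := 1)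
      (k := 0) (by norm_num) (fun x => by simp) s
    simp only [one_mul] at h
    simpa [hZ, hZ'] using h
  have hZ'd : ∀ s, HasDerivAt Z' (Z'' s) s := by
    intro s
    have h := hasDerivAt_integral_tilt hAc hδ1 hsw b (continuous_id.dotProduct continuous_const)
      (w := fun x => x ⬝ᵥ b) (k := 1) (by norm_num) (abs_dotProduct_const_le b) s
    have e : (fun x : Fin n → ℝ => (x ⬝ᵥ b) * (x ⬝ᵥ b) * exp (s * (x ⬝ᵥ b) - A x)) =
        fun x => (x ⬝ᵥ b) ^ 2 * exp (s * (x ⬝ᵥ b) - A x) := by funext x; ring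
    rw [e] at h
    exact h
  have hZpos : ∀ s, 0 < Z s := by
    intro s
    have hi := integrable_tilt hAc hδ1 hsw b s continuous_const (w := fun _ => (1:ℝ)) (D := 1) (k := 0)
      (by norm_num) (fun x => by simp)
    simp only [one_mul] at hi
    exact integral_exp_pos hi
  -- Brascamp–Lieb: `(log Z)'' ≤ σ²`
  set σ2 : ℝ := (b ⬝ᵥ b) / (1 - δ) with hσ2
  have hBL : ∀ s, Z'' s * Z s - Z' s ^ 2 ≤ σ2 * Z s ^ 2 := by
    intro s
    have h := bl_linear_tilt hA hδ1 hsw b s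
    have e : (1 - δ)⁻¹ * (b ⬝ᵥ b) = σ2 := by rw [hσ2, div_eq_inv_mul]
    rw [e] at h
    exact h
  -- the log-partition function along the segment `[0, t]` (parametrised as `u ↦ u·t`)
  set φ : ℝ → ℝ := fun u => Real.log (Z (u * t)) with hφ
  set φ' : ℝ → ℝ := fun u => (Z (u * t))⁻¹ * (Z' (u * t) * t) with hφ'
  set φ'' : ℝ → ℝ := fun u =>
    -(Z' (u * t) * t) / Z (u * t) ^ 2 * (Z' (u * t) * t) + (Z (u * t))⁻¹ * (Z'' (u * t) * t * t) with hφ''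
  have hZc : ∀ u, HasDerivAt (fun v => Z (v * t)) (Z' (u * t) * t) u := fun u => by
    have h := (hZd (u * t)).comp u (hasDerivAt_mul_const t)
    simpa [Function.comp_def] using h
  have hZ'c : ∀ u, HasDerivAt (fun v => Z' (v * t)) (Z'' (u * t) * t) u := fun u => by
    have h := (hZ'd (u * t)).comp u (hasDerivAt_mul_const t)
    simpa [Function.comp_def] using h
  have h1 : ∀ u, HasDerivAt φ (φ' u) u := fun u => by
    have h := (Real.hasDerivAt_log (hZpos (u * t)).ne').comp u (hZc u)
    simpa [hφ, hφ', Function.comp_def] using h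
  have h2 : ∀ u, HasDerivAt φ' (φ'' u) u := fun u =>
    ((hZc u).inv (hZpos (u * t)).ne').mul ((hZ'c u).mul_const t)
  have hK : ∀ u, φ'' u ≤ t ^ 2 * σ2 := by
    intro u
    have hz := hZpos (u * t)
    have hb := hBL (u * t)
    have e : φ'' u = t ^ 2 * ((Z'' (u * t) * Z (u * t) - Z' (u * t) ^ 2) / Z (u * t) ^ 2) := by
      simp only [hφ'']
      field_simp
      ring
    rw [e]
    refine mul_le_mul_of_nonneg_left ?_ (sq_nonneg t)
    rw [div_le_iff₀ (pow_pos hz 2)]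
    exact hb
  have hdesc := oneD_descent h1 h2 hK
  -- unpack: `log Z(t) ≤ log Z(0) + t Z'(0)/Z(0) + t²σ²/2`
  simp only [hφ, hφ', one_mul, zero_mul] at hdesc
  have hZ0 : Z 0 = ∫ x, exp (-A x) := by
    simp only [hZ, zero_mul, zero_sub]
  have hZ'0 : Z' 0 = ∫ x, (x ⬝ᵥ b) * exp (-A x) := by
    simp only [hZ', zero_mul, zero_sub]
  have hexp := exp_le_exp.mpr hdesc
  rw [Real.exp_log (hZpos t), Real.exp_add, Real.exp_add, Real.exp_log (hZpos 0)] at hexp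
  rw [← hZ0, ← hZ'0]
  calc (∫ x, exp (t * (x ⬝ᵥ b) - A x)) = Z t := rfl
    _ ≤ Z 0 * exp ((Z 0)⁻¹ * (Z' 0 * t)) * exp (t ^ 2 * σ2 / 2) := hexp
    _ = exp (t * (Z' 0 / Z 0) + t ^ 2 / 2 * σ2) * Z 0 := by
        rw [mul_assoc, ← Real.exp_add]
        have e : (Z 0)⁻¹ * (Z' 0 * t) + t ^ 2 * σ2 / 2 = t * (Z' 0 / Z 0) + t ^ 2 / 2 * σ2 := by
          rw [div_eq_mul_inv]; ring
        rw [e]; ring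

end Summit.QuantumFields.YangMills.Theorems.SandwichVariancePinching

end
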